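import Summits.MatrixMultiplication.MatrixMultiplication.Theorems.SoloInformedValIndexLemma

/-!
# Saturated sets: the coincidence step of the shadow lemma

Elementary facts about sets saturated by a finite set `K` of an abelian group (`∀ s ∈ S, ∀ r ∈ K, s + r ∈ S`),
used in the SHADOW LEMMA of the soloist dossier (§15.8 (n)(xx ι)): in a pure design the saturations
`S_u = A_t + (R_t + R_u)/R_t` of the row image `A_t` are saturated by `K = W̄_tu ∩ W̄_tu'`, and
`S_u' \ S_u` — being `K`-saturated and of size at most `|S_u'| − |A_t|` — is empty as soon as
`|S_u'| < |A_t| + |K|` (`subset_of_saturated_of_card_lt`, `eq_of_saturated_of_card_lt`).  Also: two disjoint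
sets whose sizes add up to `|G|` are complementary (`eq_univ_sdiff_of_disjoint_of_card`), the fact behind
"`S + c̄_u` is the complement of `S + c̄_t`" when `|S| = |G|/2`.
-/

namespace Summit.MatrixMultiplication.MatrixMultiplication.Theorems.SoloVal

open Finset

section Shadow

variable {G : Type*} [AddCommGroup G] [DecidableEq G]

/-- The difference of two `K`-saturated sets is `K`-saturated (for `K` closed under subtraction). -/
theorem saturated_sdiff {S S' K : Finset G} (hK : ∀ r ∈ K, ∀ s ∈ K, r - s ∈ K)
    (hS : ∀ s ∈ S, ∀ r ∈ K, s + r ∈ S) (hS' : ∀ s ∈ S', ∀ r ∈ K, s + r ∈ S') :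
    ∀ s ∈ S' \ S, ∀ r ∈ K, s + r ∈ S' \ S := by
  intro s hs r hr
  rw [Finset.mem_sdiff] at hs ⊢
  refine ⟨hS' s hs.1 r hr, fun h => hs.2 ?_⟩
  have h' := hS (s + r) h (-r) (subClosed_neg_mem hK hr)
  rwa [add_neg_cancel_right] at h'

/-- A nonempty `K`-saturated set has at least `|K|` elements. -/
theorem card_le_card_of_saturated {E K : Finset G} (hE : ∀ s ∈ E, ∀ r ∈ K, s + r ∈ E)
    (hne : E.Nonempty) : K.card ≤ E.card := by
  obtain ⟨g, hg⟩ := hne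
  calc K.card = (K.image fun r => g + r).card :=
        (Finset.card_image_of_injective _ (add_right_injective g)).symm
    _ ≤ E.card := Finset.card_le_card (by
        intro x hx
        obtain ⟨r, hr, rfl⟩ := Finset.mem_image.mp hx
        exact hE g hg r hr)

/-- COINCIDENCE STEP OF THE SHADOW LEMMA: if `A ⊆ S ∩ S'`, both `S` and `S'` are `K`-saturated and
`|S'| < |A| + |K|`, then `S' ⊆ S`. -/
theorem subset_of_saturated_of_card_lt {A S S' K : Finset G} (hK : ∀ r ∈ K, ∀ s ∈ K, r - s ∈ K)
    (hS : ∀ s ∈ S, ∀ r ∈ K, s + r ∈ S) (hS' : ∀ s ∈ S', ∀ r ∈ K, s + r ∈ S')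
    (hA : A ⊆ S) (hA' : A ⊆ S') (hlt : S'.card < A.card + K.card) : S' ⊆ S := by
  by_contra hnot
  have hne : (S' \ S).Nonempty := by
    rw [Finset.nonempty_iff_ne_empty, Ne, Finset.sdiff_eq_empty_iff_subset]
    exact hnot
  have hK' : K.card ≤ (S' \ S).card := card_le_card_of_saturated (saturated_sdiff hK hS hS') hne
  have hdisj : Disjoint A (S' \ S) :=
    Finset.disjoint_left.mpr fun a ha h => (Finset.mem_sdiff.mp h).2 (hA ha)
  have hsub : A ∪ (S' \ S) ⊆ S' := Finset.union_subset hA' Finset.sdiff_subset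
  have := Finset.card_le_card hsub
  rw [Finset.card_union_of_disjoint hdisj] at this
  omega

/-- Symmetric form: two `K`-saturated sets containing `A`, each of size `< |A| + |K|`, coincide. -/
theorem eq_of_saturated_of_card_lt {A S S' K : Finset G} (hK : ∀ r ∈ K, ∀ s ∈ K, r - s ∈ K)
    (hS : ∀ s ∈ S, ∀ r ∈ K, s + r ∈ S) (hS' : ∀ s ∈ S', ∀ r ∈ K, s + r ∈ S')
    (hA : A ⊆ S) (hA' : A ⊆ S') (hlt : S.card < A.card + K.card) (hlt' : S'.card < A.card + K.card) :
    S = S' :=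
  Finset.Subset.antisymm (subset_of_saturated_of_card_lt hK hS' hS hA' hA hlt)
    (subset_of_saturated_of_card_lt hK hS hS' hA hA' hlt')

omit [AddCommGroup G] in
/-- Two disjoint sets whose sizes add up to `|G|` are complementary. -/
theorem eq_univ_sdiff_of_disjoint_of_card [Fintype G] {S T : Finset G} (h : Disjoint S T)
    (hc : S.card + T.card = Fintype.card G) : T = Finset.univ \ S := by
  have hsub : T ⊆ Finset.univ \ S := by
    intro x hx
    exact Finset.mem_sdiff.mpr ⟨Finset.mem_univ x, fun hs => Finset.disjoint_left.mp h hs hx⟩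
  apply Finset.eq_of_subset_of_card_le hsub
  rw [Finset.card_univ_sdiff]
  omega

/-- Translates of one set by `a` and by `b` that are disjoint, with `2|S| = |G|`, are complementary:
`S + b = G \ (S + a)`. -/
theorem translate_eq_compl_translate [Fintype G] {S : Finset G} {a b : G}
    (h : Disjoint (S.image fun s => s + a) (S.image fun s => s + b)) (hc : 2 * S.card = Fintype.card G) :
    (S.image fun s => s + b) = Finset.univ \ S.image fun s => s + a := by
  apply eq_univ_sdiff_of_disjoint_of_card h
  rw [Finset.card_image_of_injective _ (add_left_injective a),
    Finset.card_image_of_injective _ (add_left_injective b)]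
  omega

end Shadow

end Summit.MatrixMultiplication.MatrixMultiplication.Theorems.SoloVal
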